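import Mathlib
import HarnessLib
import Summits.HubbardSuperconductivity.HubbardSuperconductivity.Theorems.KLProgrammeC4aPathJets
import Summits.HubbardSuperconductivity.HubbardSuperconductivity.Theorems.KLProgrammePerturbedFermiCurveTowerOfSizesSix

/-!
# Route `KLProgramme` — crux C4a, (L3)/(B2) PATH JETS TO ORDER SIX: every level curve in the tube obeys the extended table
# `‖γ_ρ⁽ⁱ⁾‖ ≤ msD6 A₃ A₄ A₅ A₆ i` (`1 ≤ i ≤ 6`), the pair-sum / pair-difference paths obey twice that, and `‖Dᵐ e_K‖ ≤ 4 + Aₘ` (the `K₅, K₆` rows)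

Cell `gate-hubbard-kl`, seat hubbard-kl-k3c3-p3 (g18; row «implicit-function / monotonicity route»).  Located brick «(T)-TOWER-56» for the
(C)-closer lane hubbard-kl-c4a-1 (stub (C) `stub_twoLeg_curvature` of `KLRegimeEngineV17F2`, stmt-HubbardSuperconductivity-20437; C4A-PLAN §24.9:
«(B2) … orders 3–4 at (T) wait for tables msD 5,6 / K₅,K₆»).  This is the order-six companion of `…C4aPathJets` §2 IN ITS BINDER SHAPE
(`hA`, `hA20`, `hd`, `hr`, `hlo : −1.1 < μ − r − A`, `hhi : μ + r + A < −0.1`, `hA₃`, `hA₄`) with the two extra sizes `hA₅ : ‖D⁵ frameShift K‖ ≤ A₅`,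
`hA₆ : ‖D⁶ frameShift K‖ ≤ A₆`; the table `msD6 A₃ A₄ A₅ A₆` (`…PerturbedFermiCurveTowerSixDefs`) AGREES with `msD A₃ A₄` at orders `≤ 4`
(`msD6_eq_msD`), so the order-3/4 tangency files can switch tables without touching a landed constant:

* **`norm_iteratedDeriv_levelPoint_le_six`** — `‖∂ⁱ_s Φ(ρ, s)‖ ≤ msD6 A₃ A₄ A₅ A₆ i` for `1 ≤ i ≤ 6`, `|ρ| < r` (orders 5, 6 by the generic level
  tower `…PerturbedFermiCurveLevelTowerFaaDiBruno` / `…TowerOfSizesSix`);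
* **`norm_iteratedDeriv_pairSumPath_le_six`**, **`norm_iteratedDeriv_pairDiffPath_le_six`** — `≤ 2·msD6 … i`;
* `msD6_nonneg` (`1 ≤ i ≤ 6`) (smoothness at every order is `contDiff_levelPoint_of_sizes` of `…C4aPathJets`);
* **`norm_iteratedFDeriv_frameLevel_le_five`**, **`norm_iteratedFDeriv_frameLevel_le_six`** — the `hK₅`/`hK₆` rows `‖D⁵e_K‖ ≤ 4 + A₅`,
  `‖D⁶e_K‖ ≤ 4 + A₆` (instances of `norm_iteratedFDeriv_frameLevel_le_four_add`, valid at every order).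

Proved bookkeeping; nothing about the Hubbard model's sizes; nothing asserts superconductivity.
References: BGM 2006 §2.4 Lemma 2.1 (2.40) [cite: BenfattoGiulianiMastropietro2006]; FST II CPAM 51 (1998) §3.
-/

noncomputable section

namespace Summit.HubbardSuperconductivity.HubbardSuperconductivity.Theorems.C4a

set_option linter.dupNamespace false -- summit = problem name (single-conjunct summit), D-0017

open Real Set
open Literature.MathematicalPhysics.QuantumLattice Literature.MathematicalPhysics.QuantumLattice.BandSectorCounting Literature.Probability.LatticeModels
open Summit.HubbardSuperconductivity.HubbardSuperconductivity.Theorems.KLRegimeSplit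
open Summit.HubbardSuperconductivity.HubbardSuperconductivity.Theorems.DispersionFlow
open Summit.HubbardSuperconductivity.HubbardSuperconductivity.Theorems.PerturbedFermiCurve

/-! ## §1 The band rows `K₅`, `K₆` -/

/-- **`‖D⁵ e_K‖ ≤ 4 + A₅`** on `Momentum`, from `‖D⁵ frameShift K‖ ≤ A₅` (the `hK₅` row of the (T) files). -/
theorem norm_iteratedFDeriv_frameLevel_le_five (μ : ℝ) {K : TrigPolyC4v} {A₅ : ℝ}
    (hA₅ : ∀ p : Momentum, ‖iteratedFDeriv ℝ 5 (frameShift K) p‖ ≤ A₅) (p : Momentum) :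
    ‖iteratedFDeriv ℝ 5 (frameLevel μ K) p‖ ≤ 4 + A₅ :=
  norm_iteratedFDeriv_frameLevel_le_four_add μ K (by norm_num) hA₅ p

/-- **`‖D⁶ e_K‖ ≤ 4 + A₆`** on `Momentum`, from `‖D⁶ frameShift K‖ ≤ A₆` (the `hK₆` row of the (T) files). -/
theorem norm_iteratedFDeriv_frameLevel_le_six (μ : ℝ) {K : TrigPolyC4v} {A₆ : ℝ}
    (hA₆ : ∀ p : Momentum, ‖iteratedFDeriv ℝ 6 (frameShift K) p‖ ≤ A₆) (p : Momentum) :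
    ‖iteratedFDeriv ℝ 6 (frameLevel μ K) p‖ ≤ 4 + A₆ :=
  norm_iteratedFDeriv_frameLevel_le_four_add μ K (by norm_num) hA₆ p

/-! ## §2 Every level curve in the tube obeys the extended table -/

section Sizes

variable {K : TrigPolyC4v} {A : ℝ} (hA : ∀ p : Momentum, ∀ j ≤ 2, ‖iteratedFDeriv ℝ j (frameShift K) p‖ ≤ A) (hA20 : A ≤ 1 / 20)
  (hd : klCurveD ≤ (bandBounds (show (-4 : ℝ) < -1.1 by norm_num) (show (-1.1 : ℝ) ≤ -0.1 by norm_num)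
    (show (-0.1 : ℝ) < 0 by norm_num)).Dtmin - 2 * A)
  {μ r : ℝ} (hr : 0 < r) (hlo : (-1.1 : ℝ) < μ - r - A) (hhi : μ + r + A < -0.1)
  {A₃ A₄ A₅ A₆ : ℝ} (hA₃ : ∀ p : Momentum, ‖iteratedFDeriv ℝ 3 (frameShift K) p‖ ≤ A₃)
  (hA₄ : ∀ p : Momentum, ‖iteratedFDeriv ℝ 4 (frameShift K) p‖ ≤ A₄)
  (hA₅ : ∀ p : Momentum, ‖iteratedFDeriv ℝ 5 (frameShift K) p‖ ≤ A₅)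
  (hA₆ : ∀ p : Momentum, ‖iteratedFDeriv ℝ 6 (frameShift K) p‖ ≤ A₆)
include hA hA20 hd hr hlo hhi hA₃ hA₄ hA₅ hA₆

omit hr in
/-- **Every level curve in the tube obeys the extended table**: `‖γ_ρ⁽ⁱ⁾(s)‖ ≤ msD6 A₃ A₄ A₅ A₆ i` (`1 ≤ i ≤ 6`, `|ρ| < r`).
[cite: BenfattoGiulianiMastropietro2006, §2.4 Lemma 2.1 (2.40)] -/
theorem norm_iteratedDeriv_levelPoint_le_six {ρ : ℝ} (hρ : |ρ| < r) {i : ℕ} (hi1 : 1 ≤ i) (hi6 : i ≤ 6) (s : ℝ) :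
    ‖iteratedDeriv i (levelPoint μ K ρ) s‖ ≤ msD6 A₃ A₄ A₅ A₆ i := by
  have h1 : (-1.1 : ℝ) ≤ μ + ρ - A := by have := (abs_lt.1 hρ).1; linarith
  have h2 : μ + ρ + A ≤ -0.1 := by have := (abs_lt.1 hρ).2; linarith
  have hfun : levelPoint μ K ρ = fun s : ℝ => (WithLp.toLp 2 (klFermiPoint (μ + ρ) K s) : Momentum) := rfl
  rw [hfun]
  exact norm_iteratedDeriv_fermiPointLp_le_msD6 hA hA20 hd h1 h2 hA₃ hA₄ hA₅ hA₆ s hi1 hi6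

omit hr in
/-- The extended table is nonnegative at the orders it bounds (`1 ≤ i ≤ 6`). -/
theorem msD6_nonneg {i : ℕ} (hi1 : 1 ≤ i) (hi6 : i ≤ 6) {ρ : ℝ} (hρ : |ρ| < r) : 0 ≤ msD6 A₃ A₄ A₅ A₆ i :=
  (norm_nonneg _).trans (norm_iteratedDeriv_levelPoint_le_six hA hA20 hd hlo hhi hA₃ hA₄ hA₅ hA₆ hρ hi1 hi6 0)

/-- **Jets of the pair-sum path to order six**: `‖∂ⁱ_t S_{ρ,ϑ,θ}(0)‖ ≤ 2·msD6 A₃ A₄ A₅ A₆ i` (`1 ≤ i ≤ 6`), uniformly in `θ, ϑ` and `|ρ| < r`. -/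
theorem norm_iteratedDeriv_pairSumPath_le_six (θ ρ ϑ : ℝ) (hρ : |ρ| < r) (i : ℕ) (hi1 : 1 ≤ i) (hi6 : i ≤ 6) :
    ‖iteratedDeriv i (pairSumPath μ K ρ ϑ θ) 0‖ ≤ 2 * msD6 A₃ A₄ A₅ A₆ i := by
  have h0 : |(0 : ℝ)| < r := by simpa using hr
  rw [iteratedDeriv_pairSumPath_zero hA hd hr hlo hhi hρ, two_mul]
  exact (norm_add_le _ _).trans (add_le_add
    (norm_iteratedDeriv_levelPoint_le_six hA hA20 hd hlo hhi hA₃ hA₄ hA₅ hA₆ h0 hi1 hi6 θ)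
    (norm_iteratedDeriv_levelPoint_le_six hA hA20 hd hlo hhi hA₃ hA₄ hA₅ hA₆ hρ hi1 hi6 (ϑ + θ)))

/-- **Jets of the pair-difference path to order six**: `‖∂ⁱ_t D_{ρ,ϑ,θ}(0)‖ ≤ 2·msD6 A₃ A₄ A₅ A₆ i` (`1 ≤ i ≤ 6`). -/
theorem norm_iteratedDeriv_pairDiffPath_le_six (θ ρ ϑ : ℝ) (hρ : |ρ| < r) (i : ℕ) (hi1 : 1 ≤ i) (hi6 : i ≤ 6) :
    ‖iteratedDeriv i (pairDiffPath μ K ρ ϑ θ) 0‖ ≤ 2 * msD6 A₃ A₄ A₅ A₆ i := by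
  have h0 : |(0 : ℝ)| < r := by simpa using hr
  rw [iteratedDeriv_pairDiffPath_zero hA hd hr hlo hhi hρ, two_mul]
  exact (norm_sub_le _ _).trans (add_le_add
    (norm_iteratedDeriv_levelPoint_le_six hA hA20 hd hlo hhi hA₃ hA₄ hA₅ hA₆ h0 hi1 hi6 θ)
    (norm_iteratedDeriv_levelPoint_le_six hA hA20 hd hlo hhi hA₃ hA₄ hA₅ hA₆ hρ hi1 hi6 (ϑ + θ)))

end Sizes

end Summit.HubbardSuperconductivity.HubbardSuperconductivity.Theorems.C4a

end
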